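import Summits.BirchSwinnertonDyer.BirchSwinnertonDyer.Theorems.QuadraticBranchSignedControlPlusKatoDivisibilityBranchOntoFixedPrimesOfNamedFactsContra
import Literature.NumberTheory.EllipticCurves.IwasawaAlgebraInvolutionFixedPrimesProofs
import HarnessLib

/-!
# K8 crux 20445 `PlusKatoDivisibilityBranchOnto` over the PRINT-EXACT Kato 13.4 (Q73′): the slice at the augmentation
# prime `(T)` (orders of vanishing) and at `(p)` (`μ`-invariants), BY NAME from `{hZ, Q73′, h12}` alone

Cell `bsd-potss` (HOME `run/shared/lean/pub/bsd-potss/`), seat `bsd-potss-k8q-c2x` g9 (prover; lane B of the K8 Kato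
side, route `QuadraticBranchSignedControl`), duty T-Q73ι-1, part 3 (parts 1–2:
`…PlusKatoDivisibilityBranchOntoOfNamedFactsContra`, `…FixedPrimesOfNamedFactsContra`). HONEST FRAMING: THEOREMS ONLY —
no definition, no named fact, no instance, no `sorry`; closes no item; the named-fact inputs are displayed hypotheses
(`hZ` = `Kobayashi2003.thm62_63_73_etaColemanPoitouTate_zeta`, `h134c` = Q73′ =
`Kato2004.thm13_4_lengthAt_fineSelmerDualContra_le_of_isEulerSystemClass`, `h12` =
`Kobayashi2003.thm12_signedSelmerDual_finite_torsion`); BSD is not proved by any of this; nothing is booked.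

## What is proved

Part 2 gives, on every tower-onto row of the crux and for all binders of `QuadraticBranchPlusKatoDivisibilityAt V p`,
`ℓ_𝔭(X⁺(V'/F_∞)) ≤ ℓ_𝔭(X⁺(V/ℚ_∞)) + ℓ_𝔭(Λ/(L_p⁺(V,η,X)))` at every height-one prime `𝔭` FIXED by the Iwasawa
involution `ι`. The two `ι`-fixed primes that descent to `ℚ` reads are `(T)` and `(p)`
(`IwasawaAlgebra.comap_invol_primeT`, `…comap_invol_eq_self_of_asIdeal_eq_augIdealP`, Literature companion
`IwasawaAlgebraInvolutionFixedPrimesProofs`), whence, from `{hZ, Q73′, h12}` and NOTHING ELSE: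
* `plusKatoDivisibilityBranchOntoAtT_of_zeta_of_thm13_4Contra_of_thm12`: **`ℓ_{(T)}(X⁺(V'/F_∞)) ≤
  ℓ_{(T)}(X⁺(V/ℚ_∞)) + ord_{T=0} L_p⁺(V,η,X)`** (the ORDER-OF-VANISHING half of (RK⁺) at the quadratic branch: the
  `Λ_{(T)}`-length of the dual Selmer group of the base change is bounded by that over `ℚ` plus the order of vanishing
  of Kobayashi's `η`-branch plus `p`-adic `L`-function), with `X⁺(V'/F_∞)` finitely generated torsion;
* `plusKatoDivisibilityBranchOntoAtP_of_zeta_of_thm13_4Contra_of_thm12`: the same at `𝔭 = (p)` (`μ`-invariants):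
  `ℓ_{(p)}(X⁺(V'/F_∞)) ≤ ℓ_{(p)}(X⁺(V/ℚ_∞)) + ℓ_{(p)}(Λ/(L_p⁺(V,η,X)))`.
The LITERAL crux (the inequality at every height-one prime, i.e. `Char X⁺(V'/F_∞) ⊇ Char X⁺(V/ℚ_∞)·(L_p⁺)`) is NOT
obtained from Q73′ with `hZ` as typed (part 1 §2 prices it); these are its `ι`-safe consequences.

References: [Kobayashi2003] Thm. 1.2, 2.2, 4.1, proof of Thm. 7.4 (pp. 2–13); [Kato2004Asterisque] Thm. 13.4 (p. 226);
[Washington1997] §13.2; [GreenbergLNM1716] §1 p. 60, §4 (orders of vanishing; reading).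
-/

noncomputable section

-- justification: the `Summit.BirchSwinnertonDyer.BirchSwinnertonDyer.…` path repeats a component (route-file convention)
set_option linter.dupNamespace false
set_option autoImplicit false

open scoped Classical

open CongruenceSubgroup Field WeierstrassCurve
open Literature.NumberTheory.EllipticCurves
open Literature.NumberTheory.EllipticCurves.ModularForms
open Literature.NumberTheory.EllipticCurves.Module
open Literature.NumberTheory.GaloisRepresentations
open Summit.BirchSwinnertonDyer.Rank1Residual.Additive hiding EtaSignedSelmerDualData
open Summit.BirchSwinnertonDyer.Rank1Residual.Additive.SignedTwist
open Summit.BirchSwinnertonDyer.BirchSwinnertonDyer.Theses.QuadraticBranchSignedControl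

namespace Summit.BirchSwinnertonDyer.BirchSwinnertonDyer.Theorems

namespace KatoSideContra

variable {p : ℕ} [Fact p.Prime]

/-- `L_p⁺(V, η, X) ≠ 0` on a genuine frame (period positivity + Rohrlich through the branch predicate), hence
`ℓ_{(T)}(Λ/(L_p⁺)) ≤ ord_{T=0} L_p⁺` (the characteristic ideal of `Λ/(L)` is `(L)`; Washington §13.2).
[cite: Kobayashi2003, Thm. 3.2 and (3.4)–(3.6) (p. 7)] [cite: Washington1997, §13.2] -/
theorem lengthAt_primeT_quotient_span_le_order {V : WeierstrassCurve ℚ} [V.IsElliptic] [V.IsGloballyMinimal]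
    {N : ℕ} [NeZero N] {f : CuspForm (Gamma0 N) 2} (hp2 : p ≠ 2) (hgood : V.HasGoodReductionAtPrime p)
    (hf : IsNewformOf V f) {ϖ : ℚ}
    (hϖ : if Even (p / 2) then (ϖ : ℝ) * V.realPeriodRat = plusPeriod f
      else (ϖ : ℝ) * V.imaginaryPeriodRat = minusPeriod f)
    {Lη : IwasawaAlgebra p} (hL : IsQuadraticBranchPlusLFunction f p ϖ Lη) :
    lengthAt (IwasawaAlgebra p) (IwasawaAlgebra p ⧸ Ideal.span {Lη}) (IwasawaAlgebra.primeT p) ≤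
      PowerSeries.order Lη := by
  have hϖ0 : ϖ ≠ 0 := by
    rintro rfl
    rw [Rat.cast_zero, zero_mul, zero_mul] at hϖ
    by_cases h2 : Even (p / 2)
    · rw [if_pos h2] at hϖ
      exact (IsNewform0.plusPeriod_pos_holds hf.1 hf.coeffField_eq_bot).ne hϖ
    · rw [if_neg h2] at hϖ
      exact (IsNewform0.minusPeriod_pos_holds hf.1 hf.coeffField_eq_bot).ne hϖ
  have hL0 : Lη ≠ 0 := IsQuadraticBranchPlusLFunction.ne_zero_of_isNewformOf hp2 hf hgood hϖ0 hL
  have hby : Module.IsTorsionBy (IwasawaAlgebra p) (IwasawaAlgebra p ⧸ Ideal.span {Lη}) Lη :=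
    (Module.isTorsionBy_quotient_iff _ _).mpr fun y ↦ by
      rw [smul_eq_mul]
      exact Ideal.mul_mem_right y _ (Ideal.mem_span_singleton_self _)
  have hQ : Module.IsTorsion (IwasawaAlgebra p) (IwasawaAlgebra p ⧸ Ideal.span {Lη}) :=
    fun x ↦ ⟨⟨Lη, mem_nonZeroDivisors_of_ne_zero hL0⟩, @hby x⟩
  refine IwasawaAlgebra.lengthAt_primeT_le_order _ hQ Lη ?_
  rw [charIdeal_eq_span_of_lengthAt_eq_quotient hL0 fun _ _ ↦ rfl]
  exact Ideal.mem_span_singleton_self _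

/-- **The `(T)`-slice of crux 20445 BY NAME from `{hZ, Q73′, h12}`: ORDER OF VANISHING.** For every tower-onto row
(`V/ℚ` globally minimal, `p ≥ 5` good, `a_p = 0`, `ρ̄_{V,p^m}` onto for all `m`) and all binders of
`QuadraticBranchPlusKatoDivisibilityAt V p`: `X⁺(V'/F_∞)` is finitely generated `Λ`-torsion and
`ℓ_{(T)}(X⁺(V'/F_∞)) ≤ ℓ_{(T)}(X⁺(V/ℚ_∞)) + ord_{T=0} L_p⁺(V, η, X)` — the prime `(T)` is fixed by `ι`
(`IwasawaAlgebra.comap_invol_primeT`), so part 2 applies, and `ℓ_{(T)}(Λ/(L)) ≤ ord_T L`. This is what the descent to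
`ℚ` (rank / order of vanishing on Gss2 rows) consumes of (RK⁺), over the PRINT-EXACT Kato 13.4.
[cite: Kobayashi2003, Thm. 4.1 (p. 8), Thm. 1.2 (p. 2), proof of Thm. 7.4 (p. 13)] [cite: Kato2004Asterisque, Thm. 13.4 (p. 226)]
[cite: Washington1997, §13.2] -/
theorem plusKatoDivisibilityBranchOntoAtT_of_zeta_of_thm13_4Contra_of_thm12
    (hZ : Kobayashi2003.thm62_63_73_etaColemanPoitouTate_zeta)
    (h134c : Kato2004.thm13_4_lengthAt_fineSelmerDualContra_le_of_isEulerSystemClass)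
    (h12 : Kobayashi2003.thm12_signedSelmerDual_finite_torsion)
    (V : WeierstrassCurve ℚ) [V.IsElliptic] [V.IsGloballyMinimal] (hp5 : 5 ≤ p)
    (hgood : V.HasGoodReductionAtPrime p) (hap : V.frobeniusTrace p = 0)
    (hsurj : ∀ m : ℕ, V.HasSurjectiveModNGaloisRep (p ^ m : ℕ))
    (F : Type) [Field F] [NumberField F] (V' : WeierstrassCurve F) [V'.IsElliptic]
    {κ : ZpExtension ℚ p} {γ : absoluteGaloisGroup ℚ} {κF : ZpExtension F p} {γF : absoluteGaloisGroup F}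
    {N : ℕ} [NeZero N] {f : CuspForm (Gamma0 N) 2}
    (hF : Module.finrank ℚ F = 2) (hθ : ∃ θ : F, θ ^ 2 = algebraMap ℚ F ((-1) ^ (p / 2) * p))
    (hC : ∃ C : VariableChange F, C • V.baseChange F = V')
    (hκ : κ.IsCyclotomic) (hγ : κ.IsTopGenerator γ) (hγc : IsCyclotomicVariable p γ)
    (hκF : κF.IsCyclotomic) (hγF : κF.IsTopGenerator γF)
    (hζ : ∃ ζ : ℤ_[p]ˣ, IsOfFinOrder ζ ∧
      ((GaloisRep.cyclotomicCharacter F p γF * ζ : ℤ_[p]ˣ) : ℤ_[p]) = (cyclotomicGenerator p : ℤ_[p]))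
    (hf : IsNewformOf V f)
    (ϖ : ℚ) (hϖ : if Even (p / 2) then (ϖ : ℝ) * V.realPeriodRat = plusPeriod f
      else (ϖ : ℝ) * V.imaginaryPeriodRat = minusPeriod f)
    (Lη : IwasawaAlgebra p) (hL : IsQuadraticBranchPlusLFunction f p ϖ Lη)
    (D : Kobayashi2003.SignedSelmerDualData V κ γ 1) (DF : Kobayashi2003.SignedSelmerDualData V' κF γF 1) :
    Module.Finite (IwasawaAlgebra p) DF.X ∧ Module.IsTorsion (IwasawaAlgebra p) DF.X ∧
      lengthAt (IwasawaAlgebra p) DF.X (IwasawaAlgebra.primeT p) ≤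
        lengthAt (IwasawaAlgebra p) D.X (IwasawaAlgebra.primeT p) + PowerSeries.order Lη := by
  have hp2 : p ≠ 2 := by omega
  obtain ⟨hfin, htor, h⟩ :=
    plusKatoDivisibilityBranchOntoFixedPrimes_of_zeta_of_thm13_4Contra_of_thm12 hZ h134c h12 V hp5 hgood hap hsurj
      F V' hF hθ hC hκ hγ hγc hκF hγF hζ hf ϖ hϖ Lη hL D DF
  refine ⟨hfin, htor, (h (IwasawaAlgebra.primeT p) (IwasawaAlgebra.height_primeT p)
    (IwasawaAlgebra.comap_invol_primeT p)).trans ?_⟩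
  exact add_le_add le_rfl (lengthAt_primeT_quotient_span_le_order hp2 hgood hf hϖ hL)

/-- **The `(p)`-slice of crux 20445 BY NAME from `{hZ, Q73′, h12}`: `μ`-INVARIANTS.** Same rows and binders; at any
point `𝔭` of `Spec Λ` with `𝔭 = (p)`: `ℓ_{(p)}(X⁺(V'/F_∞)) ≤ ℓ_{(p)}(X⁺(V/ℚ_∞)) + ℓ_{(p)}(Λ/(L_p⁺(V,η,X)))`
(`(p)` is `ι`-fixed: `IwasawaAlgebra.comap_invol_eq_self_of_asIdeal_eq_augIdealP`; clause (3) of Kato 13.4 on the onto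
rows covers `𝔭 ∋ p`). [cite: Kobayashi2003, Thm. 4.1 (p. 8), proof of Thm. 7.4 (p. 13)]
[cite: Kato2004Asterisque, Thm. 13.4 (3) (p. 226)] [cite: Washington1997, §13.2] -/
theorem plusKatoDivisibilityBranchOntoAtP_of_zeta_of_thm13_4Contra_of_thm12
    (hZ : Kobayashi2003.thm62_63_73_etaColemanPoitouTate_zeta)
    (h134c : Kato2004.thm13_4_lengthAt_fineSelmerDualContra_le_of_isEulerSystemClass)
    (h12 : Kobayashi2003.thm12_signedSelmerDual_finite_torsion)
    (V : WeierstrassCurve ℚ) [V.IsElliptic] [V.IsGloballyMinimal] (hp5 : 5 ≤ p)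
    (hgood : V.HasGoodReductionAtPrime p) (hap : V.frobeniusTrace p = 0)
    (hsurj : ∀ m : ℕ, V.HasSurjectiveModNGaloisRep (p ^ m : ℕ))
    (F : Type) [Field F] [NumberField F] (V' : WeierstrassCurve F) [V'.IsElliptic]
    {κ : ZpExtension ℚ p} {γ : absoluteGaloisGroup ℚ} {κF : ZpExtension F p} {γF : absoluteGaloisGroup F}
    {N : ℕ} [NeZero N] {f : CuspForm (Gamma0 N) 2}
    (hF : Module.finrank ℚ F = 2) (hθ : ∃ θ : F, θ ^ 2 = algebraMap ℚ F ((-1) ^ (p / 2) * p))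
    (hC : ∃ C : VariableChange F, C • V.baseChange F = V')
    (hκ : κ.IsCyclotomic) (hγ : κ.IsTopGenerator γ) (hγc : IsCyclotomicVariable p γ)
    (hκF : κF.IsCyclotomic) (hγF : κF.IsTopGenerator γF)
    (hζ : ∃ ζ : ℤ_[p]ˣ, IsOfFinOrder ζ ∧
      ((GaloisRep.cyclotomicCharacter F p γF * ζ : ℤ_[p]ˣ) : ℤ_[p]) = (cyclotomicGenerator p : ℤ_[p]))
    (hf : IsNewformOf V f)
    (ϖ : ℚ) (hϖ : if Even (p / 2) then (ϖ : ℝ) * V.realPeriodRat = plusPeriod f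
      else (ϖ : ℝ) * V.imaginaryPeriodRat = minusPeriod f)
    (Lη : IwasawaAlgebra p) (hL : IsQuadraticBranchPlusLFunction f p ϖ Lη)
    (D : Kobayashi2003.SignedSelmerDualData V κ γ 1) (DF : Kobayashi2003.SignedSelmerDualData V' κF γF 1)
    (𝔭 : PrimeSpectrum (IwasawaAlgebra p)) (h𝔭 : 𝔭.asIdeal = IwasawaAlgebra.augIdealP p) :
    lengthAt (IwasawaAlgebra p) DF.X 𝔭 ≤
      lengthAt (IwasawaAlgebra p) D.X 𝔭 + lengthAt (IwasawaAlgebra p) (IwasawaAlgebra p ⧸ Ideal.span {Lη}) 𝔭 := by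
  obtain ⟨-, -, h⟩ :=
    plusKatoDivisibilityBranchOntoFixedPrimes_of_zeta_of_thm13_4Contra_of_thm12 hZ h134c h12 V hp5 hgood hap hsurj
      F V' hF hθ hC hκ hγ hγc hκF hγF hζ hf ϖ hϖ Lη hL D DF
  have hht : 𝔭.asIdeal.height = 1 := by rw [h𝔭]; exact IwasawaAlgebra.height_augIdealP_holds p
  exact h 𝔭 hht (IwasawaAlgebra.comap_invol_eq_self_of_asIdeal_eq_augIdealP p 𝔭 h𝔭)

/-! ## Appended (g9, same session): the ι-HONEST inequality at a GENERAL height-one prime from `{hZ's frame, Q73′}` -/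

section General

variable {K₀ : Type} [Field K₀] [NumberField K₀] [(galRange (K := ℚ) K₀).Normal]
  {η : absoluteGaloisGroup ℚ →* ℤˣ} {V : WeierstrassCurve ℚ} [V.IsElliptic] [V.IsGloballyMinimal] {N : ℕ} [NeZero N]
  {f : CuspForm (Gamma0 N) 2} {ϖ : ℚ} {κ : ZpExtension ℚ p} {γ : absoluteGaloisGroup ℚ}
  {W : WeierstrassCurve ℚ} [W.IsElliptic] [ContinuousSMul ℤ_[p] (W.tateModule p)]
  [Module.Free ℤ_[p] (W.tateModule p)] [Module.Finite ℤ_[p] (W.tateModule p)]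
  {I : Kato2004.IwasawaH1Data W p κ γ} {FB : W.FineSelmerDualData κ γ}

/-- **What `{hZ, Q73′}` give at a GENERAL height-one prime `𝔭 ∌ p`, with NO symmetry input:**
`ℓ_𝔭(X(D)) + ℓ_𝔭(𝐇¹/Λz) ≤ ℓ_𝔭(Λ/(Col⁺ z)) + ℓ_{ι𝔭}(𝐇¹/Λz)` — Kobayashi's same-prime four-term road over hZ's
`Λ`-linear (7.21) plus the print-exact Kato bound read on the tree dual (`ℓ_𝔭(X₀) ≤ ℓ_{ι𝔭}(𝐇¹/Λz)`, part 1 §1).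
At an `ι`-fixed `𝔭` the two `𝐇¹/Λz` terms cancel (part 2); in general they differ by the `ι`-asymmetry of
`char(𝐇¹_Γ(T_pW)/Λz)`, which is the exact obstruction to the literal crux over Q73′ (part 1 §2). In ideal terms:
`char X(D) · char(𝐇¹/Λz) ∣ pⁿ · (Col⁺ z) · ι(char(𝐇¹/Λz))` — still enough for `ord_{T=0}` and, when the orders of
vanishing agree, for the `p`-adic valuation of the leading coefficient (both `ι`-invariant); that passage is not typed here.
[cite: Kobayashi2003, proof of Thm. 7.4 (p. 13)] [cite: Kato2004Asterisque, Thm. 13.4 (2) (p. 226), §17.13 (p. 280)] -/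
theorem lengthAt_etaSigned_add_le_of_zeta_of_thm13_4Contra
    (E : Kobayashi2003.EtaColemanPoitouTateZetaData p K₀ η V f ϖ κ γ W I FB)
    (h134c : Kato2004.thm13_4_lengthAt_fineSelmerDualContra_le_of_isEulerSystemClass)
    (hp2 : p ≠ 2) (hgood : V.HasGoodReductionAtPrime p) (hf : IsNewformOf V f)
    (hϖ : if Even (p / 2) then (ϖ : ℝ) * V.realPeriodRat = plusPeriod f
      else (ϖ : ℝ) * V.imaginaryPeriodRat = minusPeriod f)
    (hκ : κ.IsCyclotomic) (hγ : κ.IsTopGenerator γ)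
    (hv : ∃ σ : absoluteGaloisGroup ℚ,
      (∀ (n : ℕ) (t : AlgebraicClosure ℚ), t ^ p ^ n = 1 → σ • t = t) ∧
        Module.finrank ℤ_[p] ((W.tateModule p) ⧸ LinearMap.range (W.galoisRepTate p σ - 1)) = 1)
    (D : Kobayashi2003.EtaSignedSelmerDualData V κ K₀ ℚ_[p] η γ 1)
    (𝔭 : PrimeSpectrum (IwasawaAlgebra p)) (h𝔭 : 𝔭.asIdeal.height = 1)
    (hp𝔭 : PowerSeries.C (p : ℤ_[p]) ∉ 𝔭.asIdeal) :
    lengthAt (IwasawaAlgebra p) D.X 𝔭 +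
        lengthAt (IwasawaAlgebra p) (I.H ⧸ Submodule.span (IwasawaAlgebra p) {E.z}) 𝔭 ≤
      lengthAt (IwasawaAlgebra p) (IwasawaAlgebra p ⧸ Ideal.span {E.colPlus E.z}) 𝔭 +
        lengthAt (IwasawaAlgebra p) (I.H ⧸ Submodule.span (IwasawaAlgebra p) {E.z})
          (PrimeSpectrum.comap (IwasawaAlgebra.invol p).toRingHom 𝔭) := by
  have hL0 := colPlus_z_ne_zero E hp2 hgood hf hϖ
  have hz0 : E.z ≠ 0 := fun hz ↦ hL0 (by rw [hz, map_zero])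
  obtain ⟨j, k, hcj, hjk, -⟩ := E.exact_plus D
  have h4 := SignedKatoOffTwo.fourTerm_lengthAt_le (LinearMap.id : IwasawaAlgebra p →ₗ[IwasawaAlgebra p] _)
    (fun _ _ h ↦ h) E.colPlus E.colPlus_injective j k hcj hjk E.z 𝔭
  have hK := (katoBoundInv_of_contra h134c hp2 hκ hγ I FB E.z E.isEulerSystemClass_z hz0 hv).1 𝔭 h𝔭 hp𝔭
  exact h4.trans ((add_le_add hK le_rfl).trans (le_of_eq (add_comm _ _)))

end General

end KatoSideContra

end Summit.BirchSwinnertonDyer.BirchSwinnertonDyer.Theorems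

end
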